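import Mathlib
import Summits.ValiantsHypothesis.ValiantsHypothesis.Theorems.NewtonUnitEquationsDissociatedUniformTotalsLaw
import Summits.ValiantsHypothesis.ValiantsHypothesis.Theorems.NewtonUnitEquationsDissociatedUniformTotalsLawChartTops
import Summits.ValiantsHypothesis.ValiantsHypothesis.Theorems.NewtonUnitEquationsDissociatedUniformTotalsLawChartLevels
import Summits.ValiantsHypothesis.ValiantsHypothesis.Theorems.NewtonUnitEquationsDissociatedUniformTotalsLawChartLevelsTopSets
import Summits.ValiantsHypothesis.ValiantsHypothesis.Theorems.NewtonUnitEquationsDissociatedUniformTotalsLawTopKCells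
import Literature.Computability.AlgebraicComplexity.NewtonPolygonTauProductBounds
import HarnessLib

/-!
# Crux `NewtonUnitEquations.DissociatedUniform` (stmt-ValiantsHypothesis-5905): totals law — the FIBRE DEPTH of a point (fibres above it along a chart)

Tool file for the AVERAGE UNION LAW (companions `…TotalsLawDepthCells`, `…TotalsLawAverageUnion`: the mean over all `2^{|G|}`
position sets `Z` of the union total `∑_s #vert conv U_s(Z)` is `O(|G|²)`, equivalently a uniformly random subfamily of the fibres
`P_r = {a x + b (r - x)}` of a pair sumset has a union hull with `O(|G|)` vertices on average; memo
`Cruxes/DissociatedUniform/NOTES-t1g12.md` §2).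

Along the half-chart `t ↦ (σ, t)` put, for a point `v` of the plane,
`aboveFib a b σ t v = {r ∈ G : some point of P_r scores strictly more than v at time t}` — the set of FIBRES above `v`; its size is
the **fibre depth** of `v` at `t`.  A strict top of the union `⋃_{r ∈ R} P_r` at time `t` is a point whose above-fibre set misses `R`,
which is the certificate through which the companion files count subfamilies `R`.  PROVED here (arbitrary `a b : G → ℝ²`, no
injectivity, no general position):
* `aboveFib_subset_of_lt` — a strictly higher point has (weakly) fewer fibres above it;
* `rank_le_card_aboveFib_left/right` — the letters of a point of fibre depth `≤ j` have rank `≤ j` in their alphabets along the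
  chart (each strictly better letter produces a strictly higher point in a DIFFERENT fibre; cf. `…TotalsLawFibreDepth` for the
  union-of-fibres version);
* `mem_topSum_of_card_aboveFib_le` — a sumset point of depth `≤ j` lies in `topSum_j = topSet_A(j+1) + topSet_B(j+1)`
  (`…ChartLevelsTopSets.topSet`), a set of `≤ (j+1)²` points off the low-event times (`card_topSum_le`);
* **`aboveFib_eq_biUnion_topSum`** — for a point of depth `≤ j` the above-fibre set is the union of the fibres through the points of
  `topSum_j` scoring above it (every point above a shallow point is shallow): the depth set is READ OFF `≤ (j+1)²` points.
Honest label: tool lemmas; `UnionTotalsLaw`, `UnionVertBound`, `TotalsLawThree` remain OPEN; nothing here bears on VP ≠ VNP.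
[folklore: levels in arrangements of lines]
-/

set_option linter.dupNamespace false -- `ValiantsHypothesis.ValiantsHypothesis` (summit = problem) in every name

open scoped BigOperators Pointwise
open Matrix Finset

namespace Summit.ValiantsHypothesis.ValiantsHypothesis.Theorems.NewtonUnitEquationsDissociatedUniform

namespace TotalsLaw

open Literature.Computability.AlgebraicComplexity.KPTT.PlanarMinkowski

section Depth

variable {G : Type*} [AddCommGroup G] [Fintype G] [DecidableEq G]

/-- Finset model of the fibre `P_r = {a x + b (r - x) : x ∈ G}` of the pair sumset. -/
noncomputable def fibFin (a b : G → (Fin 2 → ℝ)) (r : G) : Finset (Fin 2 → ℝ) :=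
  Finset.univ.image fun x : G => a x + b (r - x)

/-- Finset model of the whole pair sumset `A + B = {a x + b y}` (the union of all fibres). -/
noncomputable def sumFin (a b : G → (Fin 2 → ℝ)) : Finset (Fin 2 → ℝ) :=
  Finset.univ.image fun p : G × G => a p.1 + b p.2

open Classical in
/-- The set of FIBRES ABOVE the point `v` at the chart weight `(σ, t)`: the indices `r` such that some point of `P_r` scores strictly
more than `v`.  Its cardinality is the fibre depth of `v` at time `t`. -/
noncomputable def aboveFib (a b : G → (Fin 2 → ℝ)) (σ t : ℝ) (v : Fin 2 → ℝ) : Finset G :=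
  Finset.univ.filter fun r => ∃ x : G, ![σ, t] ⬝ᵥ v < ![σ, t] ⬝ᵥ (a x + b (r - x))

omit [DecidableEq G] in
/-- Membership in a fibre. [folklore] -/
theorem mem_fibFin {a b : G → (Fin 2 → ℝ)} {r : G} {w : Fin 2 → ℝ} :
    w ∈ fibFin a b r ↔ ∃ x : G, a x + b (r - x) = w := by
  simp [fibFin]

omit [AddCommGroup G] [DecidableEq G] in
/-- Membership in the sumset. [folklore] -/
theorem mem_sumFin {a b : G → (Fin 2 → ℝ)} {w : Fin 2 → ℝ} :
    w ∈ sumFin a b ↔ ∃ x y : G, a x + b y = w := by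
  simp [sumFin]

omit [DecidableEq G] in
/-- A fibre point is a sumset point. [folklore] -/
theorem fibFin_subset_sumFin (a b : G → (Fin 2 → ℝ)) (r : G) : fibFin a b r ⊆ sumFin a b := by
  intro w hw
  obtain ⟨x, rfl⟩ := mem_fibFin.1 hw
  exact mem_sumFin.2 ⟨x, r - x, rfl⟩

omit [AddCommGroup G] [DecidableEq G] in
/-- `#(A + B) ≤ |G|²`. [folklore] -/
theorem card_sumFin_le (a b : G → (Fin 2 → ℝ)) : (sumFin a b).card ≤ Fintype.card G ^ 2 := by
  unfold sumFin
  calc _ ≤ (Finset.univ : Finset (G × G)).card := Finset.card_image_le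
    _ = Fintype.card G ^ 2 := by rw [Finset.card_univ, Fintype.card_prod, sq]

omit [DecidableEq G] in
/-- Membership in the above-fibre set. [folklore] -/
theorem mem_aboveFib {a b : G → (Fin 2 → ℝ)} {σ t : ℝ} {v : Fin 2 → ℝ} {r : G} :
    r ∈ aboveFib a b σ t v ↔ ∃ x : G, ![σ, t] ⬝ᵥ v < ![σ, t] ⬝ᵥ (a x + b (r - x)) := by
  classical
  simp [aboveFib]

omit [DecidableEq G] in
/-- A fibre containing a point strictly above `v` is above `v`. [folklore] -/
theorem mem_aboveFib_of_mem_fibFin {a b : G → (Fin 2 → ℝ)} {σ t : ℝ} {v w : Fin 2 → ℝ} {r : G}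
    (hw : w ∈ fibFin a b r) (hlt : ![σ, t] ⬝ᵥ v < ![σ, t] ⬝ᵥ w) : r ∈ aboveFib a b σ t v := by
  obtain ⟨x, rfl⟩ := mem_fibFin.1 hw
  exact mem_aboveFib.2 ⟨x, hlt⟩

omit [DecidableEq G] in
/-- **Monotonicity of depth**: a strictly higher point has (weakly) fewer fibres above it. [folklore] -/
theorem aboveFib_subset_of_lt {a b : G → (Fin 2 → ℝ)} {σ t : ℝ} {v w : Fin 2 → ℝ}
    (hlt : ![σ, t] ⬝ᵥ v < ![σ, t] ⬝ᵥ w) : aboveFib a b σ t w ⊆ aboveFib a b σ t v := by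
  intro r hr
  obtain ⟨x, hx⟩ := mem_aboveFib.1 hr
  exact mem_aboveFib.2 ⟨x, hlt.trans hx⟩

omit [DecidableEq G] in
/-- **Letter rank ≤ fibre depth (left letter).**  Every point of `A = a(G)` strictly above `a x` produces, added to `b y`, a strictly
higher point in a fibre of its own; so the rank of `a x` in `A` at time `t` is at most the number of fibres above `a x + b y`.
[folklore] -/
theorem rank_le_card_aboveFib_left (a b : G → (Fin 2 → ℝ)) (σ t : ℝ) (x y : G) :
    rank σ (Finset.univ.image a) t (a x) ≤ (aboveFib a b σ t (a x + b y)).card := by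
  classical
  unfold rank
  -- choose a letter for every point of `A`
  have hch : ∀ p ∈ (Finset.univ.image a : Finset (Fin 2 → ℝ)), ∃ x' : G, a x' = p := fun p hp => by
    obtain ⟨x', -, hx'⟩ := Finset.mem_image.1 hp
    exact ⟨x', hx'⟩
  choose! ξ hξ using hch
  refine Finset.card_le_card_of_injOn (fun p => ξ p + y) (fun p hp => ?_) ?_
  · obtain ⟨hpA, hlt⟩ := Finset.mem_filter.1 hp
    rw [Finset.mem_coe, mem_aboveFib]
    refine ⟨ξ p, ?_⟩
    rw [show ξ p + y - ξ p = y by abel, hξ p hpA, dotProduct_add, dotProduct_add]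
    linarith
  · intro p hp p' hp' h
    have hpA := (Finset.mem_filter.1 (Finset.mem_coe.1 hp)).1
    have hp'A := (Finset.mem_filter.1 (Finset.mem_coe.1 hp')).1
    have : ξ p = ξ p' := add_right_cancel h
    rw [← hξ p hpA, ← hξ p' hp'A, this]

omit [DecidableEq G] in
/-- **Letter rank ≤ fibre depth (right letter).** [folklore] -/
theorem rank_le_card_aboveFib_right (a b : G → (Fin 2 → ℝ)) (σ t : ℝ) (x y : G) :
    rank σ (Finset.univ.image b) t (b y) ≤ (aboveFib a b σ t (a x + b y)).card := by
  classical
  unfold rank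
  have hch : ∀ p ∈ (Finset.univ.image b : Finset (Fin 2 → ℝ)), ∃ y' : G, b y' = p := fun p hp => by
    obtain ⟨y', -, hy'⟩ := Finset.mem_image.1 hp
    exact ⟨y', hy'⟩
  choose! η hη using hch
  refine Finset.card_le_card_of_injOn (fun p => x + η p) (fun p hp => ?_) ?_
  · obtain ⟨hpB, hlt⟩ := Finset.mem_filter.1 hp
    rw [Finset.mem_coe, mem_aboveFib]
    refine ⟨x, ?_⟩
    rw [show x + η p - x = η p by abel, hη p hpB, dotProduct_add, dotProduct_add]
    linarith
  · intro p hp p' hp' h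
    have hpB := (Finset.mem_filter.1 (Finset.mem_coe.1 hp)).1
    have hp'B := (Finset.mem_filter.1 (Finset.mem_coe.1 hp')).1
    have : η p = η p' := add_left_cancel h
    rw [← hη p hpB, ← hη p' hp'B, this]

/-- The sum of the two top sets of order `j + 1` at time `t`: the only place where points of depth `≤ j` can live. -/
noncomputable def topSum (a b : G → (Fin 2 → ℝ)) (σ : ℝ) (j : ℕ) (t : ℝ) : Finset (Fin 2 → ℝ) :=
  topSet σ (Finset.univ.image a) (j + 1) t + topSet σ (Finset.univ.image b) (j + 1) t

omit [DecidableEq G] in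
/-- **A sumset point of fibre depth `≤ j` lies in `topSet_A(j+1) + topSet_B(j+1)`.** [folklore] -/
theorem mem_topSum_of_card_aboveFib_le {a b : G → (Fin 2 → ℝ)} {σ t : ℝ} {j : ℕ} {v : Fin 2 → ℝ}
    (hv : v ∈ sumFin a b) (hd : (aboveFib a b σ t v).card ≤ j) : v ∈ topSum a b σ j t := by
  classical
  obtain ⟨x, y, rfl⟩ := mem_sumFin.1 hv
  unfold topSum topSet
  refine Finset.add_mem_add (Finset.mem_filter.2 ⟨Finset.mem_image.2 ⟨x, Finset.mem_univ _, rfl⟩, ?_⟩)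
    (Finset.mem_filter.2 ⟨Finset.mem_image.2 ⟨y, Finset.mem_univ _, rfl⟩, ?_⟩)
  · exact lt_of_le_of_lt ((rank_le_card_aboveFib_left a b σ t x y).trans hd) (Nat.lt_succ_self j)
  · exact lt_of_le_of_lt ((rank_le_card_aboveFib_right a b σ t x y).trans hd) (Nat.lt_succ_self j)

omit [AddCommGroup G] [DecidableEq G] in
/-- Points of `topSum` are sumset points. [folklore] -/
theorem topSum_subset_sumFin (a b : G → (Fin 2 → ℝ)) (σ : ℝ) (j : ℕ) (t : ℝ) : topSum a b σ j t ⊆ sumFin a b := by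
  classical
  intro w hw
  unfold topSum at hw
  obtain ⟨p, hp, q, hq, rfl⟩ := Finset.mem_add.1 hw
  obtain ⟨x, -, rfl⟩ := Finset.mem_image.1 (Finset.mem_filter.1 hp).1
  obtain ⟨y, -, rfl⟩ := Finset.mem_image.1 (Finset.mem_filter.1 hq).1
  exact mem_sumFin.2 ⟨x, y, rfl⟩

omit [AddCommGroup G] [DecidableEq G] in
/-- `#topSum ≤ (j+1)²` off the low-event times of order `< j+1` of both alphabets. [folklore] -/
theorem card_topSum_le {a b : G → (Fin 2 → ℝ)} {σ : ℝ} {j : ℕ} {t : ℝ}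
    (hA : ∀ e : ℝ × ℝ, IsLowEvent σ (Finset.univ.image a) (j + 1) e → e.1 ≠ t)
    (hB : ∀ e : ℝ × ℝ, IsLowEvent σ (Finset.univ.image b) (j + 1) e → e.1 ≠ t) :
    (topSum a b σ j t).card ≤ (j + 1) ^ 2 := by
  unfold topSum
  calc _ ≤ (topSet σ (Finset.univ.image a) (j + 1) t).card * (topSet σ (Finset.univ.image b) (j + 1) t).card :=
        Finset.card_add_le
    _ ≤ (j + 1) * (j + 1) := Nat.mul_le_mul (card_topSet_le_of_forall_ne hA) (card_topSet_le_of_forall_ne hB)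
    _ = (j + 1) ^ 2 := (sq _).symm

open Classical in
/-- The set of fibres through a point `w` (time independent). -/
noncomputable def fibresOf (a b : G → (Fin 2 → ℝ)) (w : Fin 2 → ℝ) : Finset G :=
  Finset.univ.filter fun r => w ∈ fibFin a b r

open Classical in
/-- **The above-fibre set of a shallow point is read off `topSum`.**  If `v` has fibre depth `≤ j` at time `t`, then the fibres above
`v` are exactly the fibres through the points of `topSum_j(t)` that score above `v` (every point above `v` is at least as shallow as
`v`, hence lies in `topSum`). [folklore] -/
theorem aboveFib_eq_biUnion_topSum {a b : G → (Fin 2 → ℝ)} {σ t : ℝ} {j : ℕ} {v : Fin 2 → ℝ}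
    (hd : (aboveFib a b σ t v).card ≤ j) :
    aboveFib a b σ t v =
      ((topSum a b σ j t).filter fun w => ![σ, t] ⬝ᵥ v < ![σ, t] ⬝ᵥ w).biUnion (fibresOf a b) := by
  classical
  ext r
  rw [mem_aboveFib, Finset.mem_biUnion]
  constructor
  · rintro ⟨x, hx⟩
    have hw : a x + b (r - x) ∈ sumFin a b := mem_sumFin.2 ⟨x, r - x, rfl⟩
    have hdw : (aboveFib a b σ t (a x + b (r - x))).card ≤ j :=
      (Finset.card_le_card (aboveFib_subset_of_lt hx)).trans hd
    refine ⟨a x + b (r - x), Finset.mem_filter.2 ⟨mem_topSum_of_card_aboveFib_le hw hdw, hx⟩, ?_⟩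
    unfold fibresOf
    exact Finset.mem_filter.2 ⟨Finset.mem_univ _, mem_fibFin.2 ⟨x, rfl⟩⟩
  · rintro ⟨w, hw, hr⟩
    obtain ⟨-, hlt⟩ := Finset.mem_filter.1 hw
    unfold fibresOf at hr
    obtain ⟨x, rfl⟩ := mem_fibFin.1 (Finset.mem_filter.1 hr).2
    exact ⟨x, hlt⟩

end Depth

end TotalsLaw

end Summit.ValiantsHypothesis.ValiantsHypothesis.Theorems.NewtonUnitEquationsDissociatedUniform
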